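/-
Copyright (c) 2026 the pub-hodgecm-mathlib formalisation cell (harness21).  Prover seat hodgecm-mathlib-K2Liu-p02 (g7), Track B «K2-LIT» ∕ hLiu418
#184♮, Road Φ ∕ socket #41, organ G5-a (Φ7-2), face (β0), the `hconj` letters of ★ p859905 `K2LiuMiddleInnerSectionBorelLaw.inner_law_of_unfold`
(K2Liu-p02 (g7) bus 2026-09-04T12:24Z «next, silence = GO»).  THEOREMS ONLY.
-/
import Summits.HodgeConjecture.HodgeConjecture.Theorems.K2LiuUnipDeltaCornerCoordinates   -- ★ FILE B p860079 (+ ★ α2c `frame_levi_apply`, ★ `toBlocks₁₂_blk_mul`)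
import HarnessLib

/-!
# Crux `HLiu418`, Road Φ, face (β0): CONJUGATING `N_Δ(𝔸)` BY THE LEVI — `X_{Λ(x)⁻¹ u Λ(x)} = x⁻¹ · X_u · x♯`, `x♯ = T⁻¹ (x̄⁻¹)ᵀ T`, and the
# `hconj` letters of the inner-section Borel law: modulo `N_χ(𝔸) = {X₁₁ = 0}` the conjugate of `u` is any `v ∈ N_Δ(𝔸)` with the same corner `(x⁻¹ X_u x♯)₁₁`

Cell `hodgecm-mathlib`, crux item hLiu418 = `stmt-HodgeConjecture-24832`; squad K2 ∕ K2Liu; prover K2Liu-p02 (g7).  THEOREMS ONLY (no `def`, no instance, no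
notation, no named-fact hypothesis, no `sorry`); lane `--supports stmt-HodgeConjecture-24832 --as helper`.

WHY.  ★ `inner_law_of_unfold` (K2Liu-p14 (g2), (β0-1b)) derives the Borel law of the inner section `F` from ★ `K2LiuMiddleInnerSectionUnfold.exists_corner_unfold` ((β0-1a),
K2Liu-p02 (g7)) and the letter `hconj : ∀ t, ∃ z ∈ Z, Λ(a)⁻¹ · n₂(t) · Λ(a) = z · n₂(act t)` (`Z ⊆ N_χ(𝔸)`).  This file computes the conjugation of `N_Δ(𝔸)` by the Levi
`Λ : GL_n(𝔸_L) →* H(𝔸)` of ★ α2c (`Λ ∕ hΛ` BY VALUE, as everywhere on Road Φ) in the frame coordinate `X_u = (blk u)₁₂` of ★ D9: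
* §1 `toBlocks₁₂_upper_mul_unip_mul_upper` — block algebra: `(P · (1 X; 0 1) · Q)₁₂ = P₁₁ X Q₂₂ + (P Q)₁₂` for block-upper-triangular `P, Q`;
* §2 **`toBlocks₁₂_blk_levi_inv_conj`** — `X_{Λ(x)⁻¹ u Λ(x)} = x⁻¹ · X_u · x♯` with `x♯ = T_𝔸⁻¹ ((x⁻¹)^σ)ᵀ T_𝔸` (★ `frame_levi_apply`: the frame of `Λ x` is
  `(x, ½(x − x♯); 0, x♯)`; the off-diagonal contributions cancel because the frame of `Λ(x⁻¹) Λ(x) = 1` is `1`) — the adelic twin of the local ★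
  `K2LiuUnipDeltaConjugationModulus.blkB_matA_conj_nElem`; `toBlocks₁₂_blk_levi_conj` (the other conjugation `Λ(x) u Λ(x)⁻¹`, `x ↦ x⁻¹`);
* §3 **`exists_corner_zero_levi_inv_conj_eq_mul`** — THE `hconj` SHAPE: if `v ∈ N_Δ(𝔸)` has corner `(X_v)₁₁ = (x⁻¹ X_u x♯)₁₁`, then `Λ(x)⁻¹ u Λ(x) = z · v` for some
  `z ∈ N_Δ(𝔸)` with `(X_z)₁₁ = 0`, i.e. `z ∈ N_χ(𝔸)` (★ α2d-2 `stabilizer_reflStd_iff`); at `n = 2`, `T_𝔸` diagonal (★ FILE B `exists_gramRA_eq_diagonal`):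
  **`corner_levi_inv_conj_single_of_diagonal`** (torus `x = diag(d₀, d₁)`: `(x⁻¹ · single 1 1 y · x♯)₁₁ = d₁⁻¹ · y · σ(d₁)⁻¹`, indeed the whole matrix is
  `single 1 1 (d₁⁻¹ y σ(d₁)⁻¹)`) and **`corner_levi_inv_conj_single_of_upper`** (unipotent `x = (1 b; 0 1)`: the corner is unchanged, `= y`).
References: [MoeglinWaldspurger1995] II.1.7; [HarrisKudlaSweet1996] §1 (1.11)–(1.12); [GelbartPiatetskishapiroRallis1987] Part A §1; [KudlaRallis1994] §2.
HONEST LABEL.  Count-neutral helper: `HC_CM` is proved only modulo the 7 printed citations (2 remaining named inputs: hLiu418 = `stmt-HodgeConjecture-24832`,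
h413 = `stmt-HodgeConjecture-24833`) until rung 0 closes.
-/

set_option autoImplicit false
set_option linter.dupNamespace false -- the mandated namespace repeats `HodgeConjecture.HodgeConjecture`

noncomputable section

open scoped Matrix
open NumberField IsDedekindDomain
open Literature.NumberTheory.Automorphic Literature.NumberTheory.Automorphic.UnitaryGroup Literature.NumberTheory.GaloisRepresentations
open Literature.NumberTheory.GelbartRogawski1991 Literature.NumberTheory.GelbartRogawski1991.GRConstruction
open Literature.NumberTheory.GelbartRogawski1991.AdaptedBlocks
open Literature.NumberTheory.K2Lit.SiegelDoubled
open UnitaryDualPair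
open Summit.HodgeConjecture.HodgeConjecture.Cruxes.HLiu418.K2LiuUnipDeltaCornerCoordinates
open Summit.HodgeConjecture.HodgeConjecture.Cruxes.HLiu418.K2LiuSiegelUnipotentCharacters (toBlocks₁₂_blk_mul toBlocks₁₂_blk_one toBlocks₁₂_blk_inv)
open Summit.HodgeConjecture.HodgeConjecture.Cruxes.HLiu418.K2LiuSiegelRationalLeviDecomposition (frame_levi_apply inv_conj_levi_mem_unipDelta conj_levi_mem_unipDelta)

namespace Summit.HodgeConjecture.HodgeConjecture.Cruxes.HLiu418.K2LiuUnipDeltaLeviConjugation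

/-! ## §1 Block algebra -/

/-- **`(P · (1 X; 0 1) · Q)₁₂ = P₁₁ X Q₂₂ + (P Q)₁₂`** for block-upper-triangular `P = (P₁₁ P₁₂; 0 P₂₂)`, `Q = (Q₁₁ Q₁₂; 0 Q₂₂)`. [folklore] -/
theorem toBlocks₁₂_upper_mul_unip_mul_upper {R : Type*} [CommRing R] {ι : Type*} [Fintype ι] [DecidableEq ι]
    (p₁₁ p₁₂ p₂₂ q₁₁ q₁₂ q₂₂ X : Matrix ι ι R) :
    (Matrix.fromBlocks p₁₁ p₁₂ 0 p₂₂ * Matrix.fromBlocks 1 X 0 1 * Matrix.fromBlocks q₁₁ q₁₂ 0 q₂₂).toBlocks₁₂ =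
      p₁₁ * X * q₂₂ + (Matrix.fromBlocks p₁₁ p₁₂ 0 p₂₂ * Matrix.fromBlocks q₁₁ q₁₂ 0 q₂₂).toBlocks₁₂ := by
  simp only [Matrix.fromBlocks_multiply, Matrix.toBlocks_fromBlocks₁₂, Matrix.mul_one, Matrix.mul_zero, Matrix.zero_mul, add_zero, zero_add,
    Matrix.add_mul]
  abel

variable (L : Type) [Field L] [NumberField L] [IsCMField L]

/-! ## §2 `X_{Λ(x)⁻¹ u Λ(x)} = x⁻¹ X_u x♯` (any rank) -/

section AnyRank

variable {N M n : ℕ} (e : Fin N × Fin M ≃ Fin n)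
  (dV : Fin N → L) (hdV : ∀ i, IsCMField.complexConj L (dV i) = dV i)
  (dW : Fin M → L) (hdW : ∀ i, IsCMField.complexConj L (dW i) = dW i)
  (Λ : GL (Fin n) (AdeleRing (𝓞 L) L) →* HA L e dV hdV dW hdW)
  (hΛ : ∀ g : GL (Fin n) (AdeleRing (𝓞 L) L), blk L e dV hdV dW hdW (Λ g) =
    cayR (AdeleRing (𝓞 L) L) (Fin n) * Matrix.fromBlocks (g : Matrix (Fin n) (Fin n) (AdeleRing (𝓞 L) L)) 0 0
      (((gramR L e dV hdV dW hdW).map ((algebraMap L (AdeleRing (𝓞 L) L)).comp (algebraMap (Fp L) L)))⁻¹ *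
        (((g⁻¹ : GL (Fin n) (AdeleRing (𝓞 L) L)) : Matrix (Fin n) (Fin n) (AdeleRing (𝓞 L) L)).map
          (conjAdele (Fp L) L (IsCMField.complexConj L)))ᵀ *
        (gramR L e dV hdV dW hdW).map ((algebraMap L (AdeleRing (𝓞 L) L)).comp (algebraMap (Fp L) L))) *
      cayRinv (AdeleRing (𝓞 L) L) (Fin n))

/-- the frame coordinate of `v` is the `₁₂` block of its frame `E₁ · blk v · E₂` (★ `conjE_eq`). [cite: HarrisKudlaSweet1996, §1 (1.12)] -/
theorem toBlocks₁₂_eq_toBlocks₁₂_frame (v : HA L e dV hdV dW hdW) :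
    (blk L e dV hdV dW hdW v).toBlocks₁₂ =
      (Matrix.fromBlocks (1 : Matrix (Fin n) (Fin n) (AdeleRing (𝓞 L) L)) 0 (-1) 1 * blk L e dV hdV dW hdW v * Matrix.fromBlocks 1 0 1 1).toBlocks₁₂ := by
  rw [conjE_eq, Matrix.toBlocks_fromBlocks₁₂]

include hΛ in
/-- **CONJUGATION OF `N_Δ(𝔸)` BY THE LEVI IN THE FRAME COORDINATE**: for `x ∈ GL_n(𝔸_L)` and `u ∈ N_Δ(𝔸)`,
`X_{Λ(x)⁻¹ · u · Λ(x)} = x⁻¹ · X_u · x♯`, `x♯ = T_𝔸⁻¹ · ((x⁻¹)^σ)ᵀ · T_𝔸` — the frames `(x⁻¹, ∗; 0, (x⁻¹)♯)(1 X_u; 0 1)(x, ∗; 0, x♯)` multiply by §1 and the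
`∗`-contributions are the `₁₂` block of the frame of `Λ(x)⁻¹ Λ(x) = 1`. [cite: MoeglinWaldspurger1995, II.1.7] [cite: HarrisKudlaSweet1996, §1 (1.11)–(1.12)] -/
theorem toBlocks₁₂_blk_levi_inv_conj (x : GL (Fin n) (AdeleRing (𝓞 L) L)) {u : HA L e dV hdV dW hdW} (hu : u ∈ unipDelta L e dV hdV dW hdW) :
    (blk L e dV hdV dW hdW ((Λ x)⁻¹ * u * Λ x)).toBlocks₁₂ =
      (((x⁻¹ : GL (Fin n) (AdeleRing (𝓞 L) L)) : Matrix (Fin n) (Fin n) (AdeleRing (𝓞 L) L))) * (blk L e dV hdV dW hdW u).toBlocks₁₂ * (((gramR L e dV hdV dW hdW).map ((algebraMap L (AdeleRing (𝓞 L) L)).comp (algebraMap (Fp L) L)))⁻¹ * (((((x⁻¹ : GL (Fin n) (AdeleRing (𝓞 L) L)) : Matrix (Fin n) (Fin n) (AdeleRing (𝓞 L) L)))).map (conjAdele (Fp L) L (IsCMField.complexConj L)))ᵀ * (gramR L e dV hdV dW hdW).map ((algebraMap L (AdeleRing (𝓞 L) L)).comp (algebraMap (Fp L) L))) := by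
  have hU := (mem_unipDelta_iff_conj L e dV hdV dW hdW u).1 hu
  -- the frame of `Λ(x⁻¹) Λ(x) = 1` is `1`
  have hPQ : Matrix.fromBlocks (1 : Matrix (Fin n) (Fin n) (AdeleRing (𝓞 L) L)) 0 (-1) 1 * blk L e dV hdV dW hdW (Λ x⁻¹) * Matrix.fromBlocks 1 0 1 1 *
      (Matrix.fromBlocks (1 : Matrix (Fin n) (Fin n) (AdeleRing (𝓞 L) L)) 0 (-1) 1 * blk L e dV hdV dW hdW (Λ x) * Matrix.fromBlocks 1 0 1 1) = 1 := by
    rw [← conj_blk_mul, ← map_mul, inv_mul_cancel, map_one, conj_blk_one]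
  rw [toBlocks₁₂_eq_toBlocks₁₂_frame, ← map_inv, conj_blk_mul, conj_blk_mul, hU]
  rw [frame_levi_apply L e dV hdV dW hdW Λ hΛ x⁻¹, frame_levi_apply L e dV hdV dW hdW Λ hΛ x] at hPQ ⊢
  rw [toBlocks₁₂_upper_mul_unip_mul_upper, hPQ, ← Matrix.fromBlocks_one, Matrix.toBlocks_fromBlocks₁₂, add_zero]

include hΛ in
/-- the other conjugation: `X_{Λ(x) · u · Λ(x)⁻¹} = x · X_u · (x⁻¹)♯`. [cite: MoeglinWaldspurger1995, II.1.7] -/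
theorem toBlocks₁₂_blk_levi_conj (x : GL (Fin n) (AdeleRing (𝓞 L) L)) {u : HA L e dV hdV dW hdW} (hu : u ∈ unipDelta L e dV hdV dW hdW) :
    (blk L e dV hdV dW hdW (Λ x * u * (Λ x)⁻¹)).toBlocks₁₂ =
      (((x : GL (Fin n) (AdeleRing (𝓞 L) L)) : Matrix (Fin n) (Fin n) (AdeleRing (𝓞 L) L))) * (blk L e dV hdV dW hdW u).toBlocks₁₂ * (((gramR L e dV hdV dW hdW).map ((algebraMap L (AdeleRing (𝓞 L) L)).comp (algebraMap (Fp L) L)))⁻¹ * (((((x : GL (Fin n) (AdeleRing (𝓞 L) L)) : Matrix (Fin n) (Fin n) (AdeleRing (𝓞 L) L)))).map (conjAdele (Fp L) L (IsCMField.complexConj L)))ᵀ * (gramR L e dV hdV dW hdW).map ((algebraMap L (AdeleRing (𝓞 L) L)).comp (algebraMap (Fp L) L))) := by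
  have h := toBlocks₁₂_blk_levi_inv_conj L e dV hdV dW hdW Λ hΛ x⁻¹ hu
  rwa [map_inv, inv_inv, inv_inv] at h

/-! ## §3 The `hconj` shape: conjugates agree modulo `N_χ(𝔸) = {X₁₁ = 0}` when their corners agree -/

include hΛ in
/-- **THE `hconj` SHAPE** (general rank, any corner index `(i, j)`): if `v ∈ N_Δ(𝔸)` has the same `(i,j)` coordinate as the conjugate, `(X_v) i j = (x⁻¹ X_u x♯) i j`, then
`Λ(x)⁻¹ · u · Λ(x) = z · v` for some `z ∈ N_Δ(𝔸)` with `(X_z) i j = 0` (`z := (Λ x)⁻¹ u Λ x · v⁻¹`; ★ `toBlocks₁₂_blk_mul`, `toBlocks₁₂_blk_inv`).  At `(i,j) = (1,1)`,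
`n = 2`, `(X_z)₁₁ = 0` says `z ∈ N_χ(𝔸)` (★ α2d-2 `stabilizer_reflStd_iff`). [cite: MoeglinWaldspurger1995, II.1.7] [cite: KudlaRallis1994, §2] -/
theorem exists_corner_zero_levi_inv_conj_eq_mul (x : GL (Fin n) (AdeleRing (𝓞 L) L)) {u v : HA L e dV hdV dW hdW} (hu : u ∈ unipDelta L e dV hdV dW hdW)
    (hv : v ∈ unipDelta L e dV hdV dW hdW) (i j : Fin n)
    (hcorner : (blk L e dV hdV dW hdW v).toBlocks₁₂ i j = ((((x⁻¹ : GL (Fin n) (AdeleRing (𝓞 L) L)) : Matrix (Fin n) (Fin n) (AdeleRing (𝓞 L) L))) * (blk L e dV hdV dW hdW u).toBlocks₁₂ * (((gramR L e dV hdV dW hdW).map ((algebraMap L (AdeleRing (𝓞 L) L)).comp (algebraMap (Fp L) L)))⁻¹ * (((((x⁻¹ : GL (Fin n) (AdeleRing (𝓞 L) L)) : Matrix (Fin n) (Fin n) (AdeleRing (𝓞 L) L)))).map (conjAdele (Fp L) L (IsCMField.complexConj L)))ᵀ * (gramR L e dV hdV dW hdW).map ((algebraMap L (AdeleRing (𝓞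 L) L)).comp (algebraMap (Fp L) L)))) i j) :
    ∃ z : HA L e dV hdV dW hdW, z ∈ unipDelta L e dV hdV dW hdW ∧ (blk L e dV hdV dW hdW z).toBlocks₁₂ i j = 0 ∧ (Λ x)⁻¹ * u * Λ x = z * v := by
  have hc : (Λ x)⁻¹ * u * Λ x ∈ unipDelta L e dV hdV dW hdW := inv_conj_levi_mem_unipDelta L e dV hdV dW hdW Λ hΛ x hu
  refine ⟨(Λ x)⁻¹ * u * Λ x * v⁻¹, mul_mem hc (inv_mem hv), ?_, by rw [inv_mul_cancel_right]⟩
  rw [toBlocks₁₂_blk_mul L e dV hdV dW hdW hc (inv_mem hv), toBlocks₁₂_blk_inv L e dV hdV dW hdW hv, Matrix.add_apply, Matrix.neg_apply,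
    toBlocks₁₂_blk_levi_inv_conj L e dV hdV dW hdW Λ hΛ x hu, hcorner, add_neg_cancel]

end AnyRank

/-! ## §4 `n = 2`: the corner of `x⁻¹ · single 1 1 y · x♯` for the torus and for the unipotents of the `GL₂` Borel -/

section Two

variable {N M : ℕ} (e : Fin N × Fin M ≃ Fin 2)
  (dV : Fin N → L) (hdV : ∀ i, IsCMField.complexConj L (dV i) = dV i)
  (dW : Fin M → L) (hdW : ∀ i, IsCMField.complexConj L (dW i) = dW i)

/-- **TORUS**: for `x = diag(d₀, d₁)` (units `dᵢ ∈ 𝔸_L`) and `T_𝔸` diagonal, `x⁻¹ · single 1 1 y · x♯ = single 1 1 (d₁⁻¹ · y · σ(d₁)⁻¹)` (`x♯ = T⁻¹ diag(σ(dᵢ)⁻¹) T = diag(σ(dᵢ)⁻¹)`).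
[cite: MoeglinWaldspurger1995, II.1.7] [cite: KudlaRallis1994, §2] -/
theorem levi_inv_conj_single_of_diagonal (hdV0 : ∀ i, dV i ≠ 0) (hdW0 : ∀ i, dW i ≠ 0) (d : Fin 2 → (AdeleRing (𝓞 L) L)ˣ)
    (x : GL (Fin 2) (AdeleRing (𝓞 L) L)) (hx : (x : Matrix (Fin 2) (Fin 2) (AdeleRing (𝓞 L) L)) = Matrix.diagonal fun i => (d i : AdeleRing (𝓞 L) L))
    (y : AdeleRing (𝓞 L) L) :
    (((x⁻¹ : GL (Fin 2) (AdeleRing (𝓞 L) L)) : Matrix (Fin 2) (Fin 2) (AdeleRing (𝓞 L) L))) * Matrix.single 1 1 y * (((gramR L e dV hdV dW hdW).map ((algebraMap L (AdeleRing (𝓞 L) L)).comp (algebraMap (Fp L) L)))⁻¹ * (((((x⁻¹ : GL (Fin 2) (AdeleRing (𝓞 L) L)) : Matrix (Fin 2) (Fin 2) (AdeleRing (𝓞 L) L)))).map (conjAdele (Fp L) L (IsCMField.complexConj L)))ᵀ * (gramR L e dV hdV dW hdW).map ((algebraMap L (AdeleRing (𝓞 L) L)).comp (algebraMap (Fp L)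 L))) =
      Matrix.single 1 1 (((d 1)⁻¹ : (AdeleRing (𝓞 L) L)ˣ) * y * conjAdele (Fp L) L (IsCMField.complexConj L) ↑((d 1)⁻¹)) := by
  obtain ⟨t, ht0, hT⟩ := exists_gramRA_eq_diagonal L e dV hdV dW hdW hdV0 hdW0
  -- `x⁻¹ = diag(dᵢ⁻¹)`
  have hxinv : (((x⁻¹ : GL (Fin 2) (AdeleRing (𝓞 L) L)) : Matrix (Fin 2) (Fin 2) (AdeleRing (𝓞 L) L))) =
      Matrix.diagonal fun i => (((d i)⁻¹ : (AdeleRing (𝓞 L) L)ˣ) : AdeleRing (𝓞 L) L) := by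
    have h1 : (Matrix.diagonal fun i => (((d i)⁻¹ : (AdeleRing (𝓞 L) L)ˣ) : AdeleRing (𝓞 L) L)) * (x : Matrix (Fin 2) (Fin 2) (AdeleRing (𝓞 L) L)) = 1 := by
      rw [hx, Matrix.diagonal_mul_diagonal, ← Matrix.diagonal_one]
      congr 1
      funext i
      rw [Units.inv_mul]
    rw [Matrix.coe_units_inv]
    exact Matrix.inv_eq_left_inv h1
  -- the unit diagonal `T`
  have hTunit : ∀ i, IsUnit (((algebraMap L (AdeleRing (𝓞 L) L)).comp (algebraMap (Fp L) L)) (t i)) := fun i => (IsUnit.mk0 _ (ht0 i)).map _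
  have hTinv : ((gramR L e dV hdV dW hdW).map ((algebraMap L (AdeleRing (𝓞 L) L)).comp (algebraMap (Fp L) L)))⁻¹ =
      Matrix.diagonal fun i => Ring.inverse (((algebraMap L (AdeleRing (𝓞 L) L)).comp (algebraMap (Fp L) L)) (t i)) := by
    rw [hT]
    refine Matrix.inv_eq_left_inv ?_
    rw [Matrix.diagonal_mul_diagonal, ← Matrix.diagonal_one]
    congr 1
    funext i
    exact Ring.inverse_mul_cancel _ (hTunit i)
  rw [hTinv, hT, hxinv, Matrix.diagonal_map (map_zero _), Matrix.diagonal_transpose, Matrix.diagonal_mul_diagonal, Matrix.diagonal_mul_diagonal]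
  ext a b
  rw [Matrix.mul_apply, Fintype.sum_eq_single b (fun c hc => by rw [Matrix.diagonal_apply_ne _ hc, mul_zero]), Matrix.diagonal_apply_eq,
    Matrix.diagonal_mul]
  by_cases hab : (1 : Fin 2) = a ∧ (1 : Fin 2) = b
  · obtain ⟨rfl, rfl⟩ := hab
    rw [Matrix.single_apply_same, Matrix.single_apply_same, mul_right_comm (Ring.inverse _), Ring.inverse_mul_cancel _ (hTunit 1), one_mul]
  · rw [Matrix.single_apply_of_ne (h := hab), Matrix.single_apply_of_ne (h := hab), mul_zero, zero_mul]

/-- **UNIPOTENT**: for `x = (1 b; 0 1)` and `T_𝔸` diagonal the corner is unchanged: `(x⁻¹ · single 1 1 y · x♯)₁₁ = y` (`x⁻¹` is upper, `x♯` is lower unipotent).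
[cite: MoeglinWaldspurger1995, II.1.7] [cite: KudlaRallis1994, §2] -/
theorem corner_levi_inv_conj_single_of_upper (hdV0 : ∀ i, dV i ≠ 0) (hdW0 : ∀ i, dW i ≠ 0) (x : GL (Fin 2) (AdeleRing (𝓞 L) L))
    (hx10 : (x : Matrix (Fin 2) (Fin 2) (AdeleRing (𝓞 L) L)) 1 0 = 0) (hx00 : (x : Matrix (Fin 2) (Fin 2) (AdeleRing (𝓞 L) L)) 0 0 = 1)
    (hx11 : (x : Matrix (Fin 2) (Fin 2) (AdeleRing (𝓞 L) L)) 1 1 = 1) (y : AdeleRing (𝓞 L) L) :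
    ((((x⁻¹ : GL (Fin 2) (AdeleRing (𝓞 L) L)) : Matrix (Fin 2) (Fin 2) (AdeleRing (𝓞 L) L))) * Matrix.single 1 1 y * (((gramR L e dV hdV dW hdW).map ((algebraMap L (AdeleRing (𝓞 L) L)).comp (algebraMap (Fp L) L)))⁻¹ * (((((x⁻¹ : GL (Fin 2) (AdeleRing (𝓞 L) L)) : Matrix (Fin 2) (Fin 2) (AdeleRing (𝓞 L) L)))).map (conjAdele (Fp L) L (IsCMField.complexConj L)))ᵀ * (gramR L e dV hdV dW hdW).map ((algebraMap L (AdeleRing (𝓞 L) L)).comp (algebraMap (Fp L) L))) : Matrix (Fin 2) (Fin 2) (AdeleRing (𝓞 L) L)) 1 1 = y := by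
  obtain ⟨t, ht0, hT⟩ := exists_gramRA_eq_diagonal L e dV hdV dW hdW hdV0 hdW0
  have hTunit : ∀ i, IsUnit (((algebraMap L (AdeleRing (𝓞 L) L)).comp (algebraMap (Fp L) L)) (t i)) := fun i => (IsUnit.mk0 _ (ht0 i)).map _
  -- the inverse of `x` is upper unitriangular as well
  have hdet : (x : Matrix (Fin 2) (Fin 2) (AdeleRing (𝓞 L) L)).det = 1 := by rw [Matrix.det_fin_two, hx00, hx11, hx10, mul_zero, sub_zero, mul_one]
  have hinv : (((x⁻¹ : GL (Fin 2) (AdeleRing (𝓞 L) L)) : Matrix (Fin 2) (Fin 2) (AdeleRing (𝓞 L) L))) =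
      !![1, -(x : Matrix (Fin 2) (Fin 2) (AdeleRing (𝓞 L) L)) 0 1; 0, 1] := by
    rw [Matrix.coe_units_inv, Matrix.inv_def, hdet, Ring.inverse_one, one_smul, Matrix.adjugate_fin_two, hx00, hx11, hx10, neg_zero]
  have hTinv : ((gramR L e dV hdV dW hdW).map ((algebraMap L (AdeleRing (𝓞 L) L)).comp (algebraMap (Fp L) L)))⁻¹ =
      Matrix.diagonal fun i => Ring.inverse (((algebraMap L (AdeleRing (𝓞 L) L)).comp (algebraMap (Fp L) L)) (t i)) := by
    rw [hT]
    refine Matrix.inv_eq_left_inv ?_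
    rw [Matrix.diagonal_mul_diagonal, ← Matrix.diagonal_one]
    congr 1
    funext i
    exact Ring.inverse_mul_cancel _ (hTunit i)
  rw [hTinv, hT, hinv]
  simp only [Matrix.mul_apply, Fin.sum_univ_two, Matrix.diagonal_apply_eq, Matrix.diagonal_apply_ne _ (by decide : (0 : Fin 2) ≠ 1),
    Matrix.transpose_apply, Matrix.map_apply, Matrix.of_apply, Matrix.cons_val', Matrix.cons_val_zero, Matrix.cons_val_one, Matrix.empty_val',
    Matrix.cons_val_fin_one, Matrix.single_apply_same, Matrix.single_apply_of_ne (h := (by decide : ¬((1 : Fin 2) = 1 ∧ (1 : Fin 2) = 0))),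
    map_one, map_zero, mul_zero, zero_mul, zero_add, mul_one, one_mul]
  rw [Ring.inverse_mul_cancel _ (hTunit 1), mul_one]

end Two

end Summit.HodgeConjecture.HodgeConjecture.Cruxes.HLiu418.K2LiuUnipDeltaLeviConjugation

end
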